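import Summits.QuantumFields.BalabanUV.T4Continuum.Support.NE9FutureProfileEndOfRecord
import Summits.QuantumFields.BalabanUV.T4Continuum.Support.NE9EllInftyHolomorphy
import Literature.Analysis.Complex.SymmetryPrincipleBanach

/-!
# NE9HoloSliceOfFamily — route R4's slice map `ΦY` BUILT from a complex new-term FAMILY map: (♭) the ℓ^∞-packing of the
# decay-weighted, (δ) σ-SYMMETRISED coordinates `Q ↦ e^{κd(X)}·½(Φc k s Q U X + conj (Φc k s (σQ) U X))` on the creation step
# `k+1`; its three clauses (Φ-holo)∕(Φ-size)∕(Φ-real) of the END OF RECORD `NE9FutureProfileEndOfRecord` PROVED from per-coordinate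
# Fréchet holomorphy + a decay-weighted bound + «Re Φc at the record's tables = the record's new term» + a conjugation `σ` of the
# table space fixing the record's readings; and the COMPOSED END (INTERFACE REQUEST NE9 (R4-4), owner; leaf-02 g30∕g31's (δ))

Cell `pub-balaban`, T4-DAG §6 NE9; BINDER row NE9 OWNER lineage `b2b-balaban-t4-ne9-p1` gen 60, CRUX PROVER NE9 (ruling e34b3e0c (2));
route R4 «fading by Earle–Hamilton» (`t4/ROUTES-NE9.md` v4 §L1.0 EH2 (ii)–(iii), §V4 (3) (O-R4-2)∕(O-R4-3); leaf-02 g30 item (δ)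
F-ne9leaf02g30-1: the record's new-term map is a REAL PART — cure by Schwarz reflection).  Letters: `Pot := lp (ι → ℂ) ∞`,
`𝔜 := lp (Bg × C.Dom → ℂ) ∞`; `σ : Pot →L[ℝ] Pot` a conjugate-linear isometry fixing the weighted readings of real tables (for `Pot`
it is Mathlib's `star` — leaf-02 g31 `SymmetryPrincipleBanachStar`; here ABSTRACT, displayed as three hypotheses).
HONEST FRAMING (T4-DAG PAGE 1).  Rung (B)+1 of the FINITE-VOLUME T⁴ programme — NOT infinite volume, NOT a mass gap, NOT Clay.  NE9
(`T4OutputRate.NE9` ∧ `FadingMemory`) is a cell NEW ESTIMATE, NOT PRINTED in [I] = [Balaban1987RG1] (CMP **109**), [II] =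
[Balaban1988RG2Cluster] (CMP **116**), NOT PROVED for Bałaban's E^{(j)} («NE9 ⇐ the named binders»): the per-coordinate clauses
(c-holo)∕(c-size)∕(c-real) below are the INSTANCE's burden — (R-0)[scope] on the inflated box (holomorphy + majorant of the
activities ⇒ of the cluster sum, `B13LocEAnalytic`-type) and the model O-NE9-1 (W1); spine 0∕9.  HONEST DEPENDENCY (cell line,
verbatim): continuum YM on T⁴ ⇐ BetaPertH ∧ nine spine estimates (0/9 proved); BetaPertH ⇐ (D1) ∧ (D4) ∧ CAP+tail; G-an2-4 gates
asym, D1 and NE2/3/4.  `FlowStep.BetaPertH`, (B), (B^μ) do not occur; [I]∕[II] for TYPES only (ABSOLUTE RULE).  0 sorry.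
CONTENT ([folklore]; one data def): §1 `symC σ f` (the σ-symmetrised scalar map) and **`holoSlice κ σ Φc k s : Pot → 𝔜`**; §2
`coordFun_differentiableOn`, `coordFun_bound` (per coordinate: holomorphic on the table ball, weighted size `≤ B₁`);
**`holoSlice_differentiableOn`** = (Φ-holo) (`NE9EllInftyHolomorphy.differentiableOn_pack`), **`holoSlice_mapsTo`** = (Φ-size),
**`holoSlice_apply_of_fixed`** (at a σ-fixed table in the ball the weighted coordinates are `e^{κd(X)}·Re Φc` on the creation step,
`SymmetryPrincipleBanach.symmetrise_of_fixed`), **`holoSlice_real`** = (Φ-real) for a functional with `Ψ k s P U X = Re (Φc k s (ρ k P)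
U X)` at the record's tables; §3 **`ne9_and_fadingMemory_of_holoFamily`** — THE COMPOSED END: `NE9FutureProfileEndOfRecord.
ne9_and_fadingMemory_of_holoSlice` with `ΦY := holoSlice κ σ Φc`.  DISGUISE TEST: composition of generic kernels; nothing of Bałaban's.
References (TYPES only): [Balaban1988RG2Cluster] CMP **116** (2.13)–(2.15) pp. 14–15, (1.36) p. 9; [Balaban1987RG1] CMP **109** (2.13)
p. 268, (0.23)–(0.26) pp. 256–257 (real effective actions at real fields — the TYPE behind (Φ-real)); [AhlforsCA1979] Ch. 4 §6.5 p. 172.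
-/

noncomputable section

namespace Summit.QuantumFields.BalabanUV.T4Continuum.NE9HoloSliceOfFamily

open Metric Set ComplexConjugate
open scoped BigOperators ENNReal
open Literature.MathematicalPhysics.QuantumFieldTheory.Balaban1983to89
open Literature.MathematicalPhysics.QuantumFieldTheory.Balaban1983to89.T4OutputRate
open Literature.MathematicalPhysics.QuantumFieldTheory.Balaban1983to89.T4HistoryLipschitzRecursion
open Literature.MathematicalPhysics.QuantumFieldTheory.Balaban1983to89.T4HistoryLipschitzOuter
open Literature.Analysis.Complex.SymmetryPrincipleBanach
open Summit.QuantumFields.BalabanUV.T4Continuum.NE9EllInftyHolomorphy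
open Summit.QuantumFields.BalabanUV.T4Continuum.NE9TableReading
open Summit.QuantumFields.BalabanUV.T4Continuum.NE9FutureProfileEndOfRecord

variable {C : Carriers} {Bg ι : Type}

/-! ## §1 The symmetrised, weighted, packed slice map -/

/-- [folklore] The σ-SYMMETRISED scalar map `Q ↦ ½(f Q + conj (f (σ Q)))` (Schwarz reflection through the conjugation `σ`;
`SymmetryPrincipleBanach`). [cite: AhlforsCA1979, Ch. 4 §6.5 p. 172] -/
def symC (σ : lp (fun _ : ι => ℂ) ∞ →L[ℝ] lp (fun _ : ι => ℂ) ∞) (f : lp (fun _ : ι => ℂ) ∞ → ℂ)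
    (Q : lp (fun _ : ι => ℂ) ∞) : ℂ :=
  (f Q + conj (f (σ Q))) / 2

/-- [folklore] The weighted coordinate functions of the slice map: on the creation step `k+1` the decay-weighted symmetrised
new-term coordinate, zero elsewhere. -/
def coordFun (κ : ℝ) (σ : lp (fun _ : ι => ℂ) ∞ →L[ℝ] lp (fun _ : ι => ℂ) ∞)
    (Φc : ℕ → ℝ → lp (fun _ : ι => ℂ) ∞ → Bg → C.Dom → ℂ) (k : ℕ) (s : ℝ) :
    Bg × C.Dom → lp (fun _ : ι => ℂ) ∞ → ℂ :=
  fun p Q => if C.scale p.2 = k + 1 then (Real.exp (κ * C.d p.2) : ℂ) * symC σ (fun Q => Φc k s Q p.1 p.2) Q else 0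

/-- **THE SLICE MAP `ΦY` OF ROUTE R4 BUILT FROM A COMPLEX FAMILY MAP** (EH2: the new scale-`(k+1)` slice as a function of the
complex table): the ℓ^∞-PACKING over `(U, X)` of the weighted symmetrised coordinates (`NE9EllInftyHolomorphy.pack`).
[cite: Balaban1988RG2Cluster, (2.13) p.14] -/
def holoSlice (κ : ℝ) (σ : lp (fun _ : ι => ℂ) ∞ →L[ℝ] lp (fun _ : ι => ℂ) ∞)
    (Φc : ℕ → ℝ → lp (fun _ : ι => ℂ) ∞ → Bg → C.Dom → ℂ) (k : ℕ) (s : ℝ) :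
    lp (fun _ : ι => ℂ) ∞ → lp (fun _ : Bg × C.Dom => ℂ) ∞ :=
  pack (coordFun κ σ Φc k s)

/-! ## §2 The three clauses of the END OF RECORD, per coordinate and packed -/

section Clauses

variable {κ : ℝ} {σ : lp (fun _ : ι => ℂ) ∞ →L[ℝ] lp (fun _ : ι => ℂ) ∞}
  {Φc : ℕ → ℝ → lp (fun _ : ι => ℂ) ∞ → Bg → C.Dom → ℂ} {r B₁ : ℝ} {k : ℕ} {s : ℝ}

/-- [folklore] An isometric `σ` maps every ball about `0` into itself. -/
theorem mapsTo_ball_of_iso (hiso : ∀ x, ‖σ x‖ = ‖x‖) (R : ℝ) :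
    MapsTo σ (ball (0 : lp (fun _ : ι => ℂ) ∞) R) (ball 0 R) := fun x hx => by
  rw [mem_ball_zero_iff] at hx ⊢; rwa [hiso]

/-- [folklore] `coordFun` on the creation step, unfolded. -/
theorem coordFun_of_eq {U : Bg} {X : C.Dom} (hX : C.scale X = k + 1) (Q : lp (fun _ : ι => ℂ) ∞) :
    coordFun κ σ Φc k s (U, X) Q =
      (Real.exp (κ * C.d X) : ℂ) * ((Φc k s Q U X + conj (Φc k s (σ Q) U X)) / 2) := by
  simp only [coordFun, symC, hX, if_true]

/-- [folklore] `coordFun` off the creation step vanishes. -/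
theorem coordFun_of_ne {U : Bg} {X : C.Dom} (hX : C.scale X ≠ k + 1) (Q : lp (fun _ : ι => ℂ) ∞) :
    coordFun κ σ Φc k s (U, X) Q = 0 := by
  simp only [coordFun, hX, if_false]

/-- **(c-holo) ⇒ every weighted coordinate is holomorphic on the table ball** (Schwarz reflection keeps holomorphy:
`SymmetryPrincipleBanach.differentiableOn_symmetrise`). [folklore] -/
theorem coordFun_differentiableOn (hσ : ∀ (c : ℂ) (x : lp (fun _ : ι => ℂ) ∞), σ (c • x) = conj c • σ x)
    (hiso : ∀ x, ‖σ x‖ = ‖x‖)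
    (hd : ∀ (U : Bg) (X : C.Dom), C.scale X = k + 1 → DifferentiableOn ℂ (fun Q => Φc k s Q U X) (ball 0 r))
    (p : Bg × C.Dom) : DifferentiableOn ℂ (coordFun κ σ Φc k s p) (ball 0 r) := by
  obtain ⟨U, X⟩ := p
  by_cases hX : C.scale X = k + 1
  · have h := differentiableOn_symmetrise σ hσ isOpen_ball (mapsTo_ball_of_iso hiso r) (hd U X hX)
    refine ((differentiableOn_const (Real.exp (κ * C.d X) : ℂ)).mul h).congr fun Q _ => ?_
    exact coordFun_of_eq hX Q
  · exact (differentiableOn_const (0 : ℂ)).congr fun Q _ => coordFun_of_ne hX Q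

/-- **(c-size) ⇒ the weighted coordinates are UNIFORMLY bounded by `B₁` on the table ball** (the symmetrised map has the same
bound; the weight `e^{κd(X)}` cancels the decay factor). [folklore] -/
theorem coordFun_bound (hσ : ∀ (c : ℂ) (x : lp (fun _ : ι => ℂ) ∞), σ (c • x) = conj c • σ x)
    (hiso : ∀ x, ‖σ x‖ = ‖x‖) (hB₁ : 0 ≤ B₁)
    (hd : ∀ (U : Bg) (X : C.Dom), C.scale X = k + 1 → DifferentiableOn ℂ (fun Q => Φc k s Q U X) (ball 0 r))
    (hb : ∀ (U : Bg) (X : C.Dom), C.scale X = k + 1 →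
      ∀ Q ∈ ball (0 : lp (fun _ : ι => ℂ) ∞) r, ‖Φc k s Q U X‖ ≤ Real.exp (-(κ * C.d X)) * B₁)
    (p : Bg × C.Dom) : ∀ Q ∈ ball (0 : lp (fun _ : ι => ℂ) ∞) r, ‖coordFun κ σ Φc k s p Q‖ ≤ B₁ := by
  intro Q hQ
  obtain ⟨U, X⟩ := p
  by_cases hX : C.scale X = k + 1
  · have h := (symmetrise_ball σ hσ hiso (hd U X hX) (hb U X hX)).2.1 Q hQ
    rw [coordFun_of_eq hX, norm_mul, Complex.norm_real, Real.norm_of_nonneg (Real.exp_pos _).le]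
    calc Real.exp (κ * C.d X) * ‖(Φc k s Q U X + conj (Φc k s (σ Q) U X)) / 2‖
        ≤ Real.exp (κ * C.d X) * (Real.exp (-(κ * C.d X)) * B₁) := mul_le_mul_of_nonneg_left h (Real.exp_pos _).le
      _ = B₁ := by rw [← mul_assoc, ← Real.exp_add, add_neg_cancel, Real.exp_zero, one_mul]
  · rw [coordFun_of_ne hX, norm_zero]; exact hB₁

/-- **(Φ-holo) — THE SLICE MAP IS FRÉCHET-HOLOMORPHIC ON THE TABLE BALL** ((♭) `NE9EllInftyHolomorphy.differentiableOn_pack`: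
coordinatewise holomorphy + the UNIFORM bound). [folklore] -/
theorem holoSlice_differentiableOn (hσ : ∀ (c : ℂ) (x : lp (fun _ : ι => ℂ) ∞), σ (c • x) = conj c • σ x)
    (hiso : ∀ x, ‖σ x‖ = ‖x‖) (hB₁ : 0 ≤ B₁)
    (hd : ∀ (U : Bg) (X : C.Dom), C.scale X = k + 1 → DifferentiableOn ℂ (fun Q => Φc k s Q U X) (ball 0 r))
    (hb : ∀ (U : Bg) (X : C.Dom), C.scale X = k + 1 →
      ∀ Q ∈ ball (0 : lp (fun _ : ι => ℂ) ∞) r, ‖Φc k s Q U X‖ ≤ Real.exp (-(κ * C.d X)) * B₁) :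
    DifferentiableOn ℂ (holoSlice κ σ Φc k s) (ball 0 r) :=
  differentiableOn_pack isOpen_ball (coordFun_differentiableOn hσ hiso hd) (coordFun_bound hσ hiso hB₁ hd hb)

/-- **(Φ-size) — THE SLICE MAP MAPS THE TABLE BALL INTO `closedBall 0 B₁`.** [folklore] -/
theorem holoSlice_mapsTo (hσ : ∀ (c : ℂ) (x : lp (fun _ : ι => ℂ) ∞), σ (c • x) = conj c • σ x)
    (hiso : ∀ x, ‖σ x‖ = ‖x‖) (hB₁ : 0 ≤ B₁)
    (hd : ∀ (U : Bg) (X : C.Dom), C.scale X = k + 1 → DifferentiableOn ℂ (fun Q => Φc k s Q U X) (ball 0 r))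
    (hb : ∀ (U : Bg) (X : C.Dom), C.scale X = k + 1 →
      ∀ Q ∈ ball (0 : lp (fun _ : ι => ℂ) ∞) r, ‖Φc k s Q U X‖ ≤ Real.exp (-(κ * C.d X)) * B₁) :
    MapsTo (holoSlice κ σ Φc k s) (ball (0 : lp (fun _ : ι => ℂ) ∞) r) (closedBall 0 B₁) :=
  mapsTo_pack_closedBall hB₁ (coordFun_bound hσ hiso hB₁ hd hb)

/-- **AT A σ-FIXED TABLE THE WEIGHTED COORDINATES ARE REAL: `e^{κd(X)}·Re Φc` on the creation step** (`symmetrise_of_fixed`; the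
packing is the tuple on the bounded locus). [folklore] -/
theorem holoSlice_apply_of_fixed (hσ : ∀ (c : ℂ) (x : lp (fun _ : ι => ℂ) ∞), σ (c • x) = conj c • σ x)
    (hiso : ∀ x, ‖σ x‖ = ‖x‖) (hB₁ : 0 ≤ B₁)
    (hd : ∀ (U : Bg) (X : C.Dom), C.scale X = k + 1 → DifferentiableOn ℂ (fun Q => Φc k s Q U X) (ball 0 r))
    (hb : ∀ (U : Bg) (X : C.Dom), C.scale X = k + 1 →
      ∀ Q ∈ ball (0 : lp (fun _ : ι => ℂ) ∞) r, ‖Φc k s Q U X‖ ≤ Real.exp (-(κ * C.d X)) * B₁)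
    {Q : lp (fun _ : ι => ℂ) ∞} (hQ : Q ∈ ball (0 : lp (fun _ : ι => ℂ) ∞) r) (hfix : σ Q = Q) (U : Bg) (X : C.Dom) :
    (holoSlice κ σ Φc k s Q : Bg × C.Dom → ℂ) (U, X) =
      if C.scale X = k + 1 then ((Real.exp (κ * C.d X) * (Φc k s Q U X).re : ℝ) : ℂ) else 0 := by
  rw [holoSlice, pack_apply_of_bound (fun p => coordFun_bound hσ hiso hB₁ hd hb p Q hQ)]
  by_cases hX : C.scale X = k + 1
  · have h2 : (Φc k s Q U X + conj (Φc k s (σ Q) U X)) / 2 = ((Φc k s Q U X).re : ℂ) :=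
      symmetrise_of_fixed σ (fun Q => Φc k s Q U X) hfix
    rw [if_pos hX, coordFun_of_eq hX, h2]
    push_cast; ring
  · rw [if_neg hX, coordFun_of_ne hX]

end Clauses

/-! ## §3 The composed END: route R4 at the record from a complex family map -/

section End

variable {E : Functional C Bg} {W : Set (ℕ → ℝ)} {Adm : Set (Bg → C.Dom → ℝ)}
  {T : ℕ → (ℕ → ℝ) → (Bg → C.Dom → ℝ) → ι → ℝ} {Ψ : ℕ → ℝ → (ι → ℝ) → Bg → C.Dom → ℝ}
  {κ : ℝ} {wt : ℕ → ι → ℝ} {τ : ℕ → ℕ → ℝ} {τbar ω ωh : ℝ}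

/-- **(Φ-real) FROM (c-real)**: if the conjugation fixes the weighted readings of real tables and the record's new term at the
record's tables is the REAL PART of the complex family map there, then the slice map's weighted coordinates at those tables
are real and equal the record's new slice — the END OF RECORD's hypothesis `hreal` LITERALLY. [cite: Balaban1987RG1, (0.23)-(0.26) pp.256-257] -/
theorem holoSlice_real {σ : lp (fun _ : ι => ℂ) ∞ →L[ℝ] lp (fun _ : ι => ℂ) ∞}
    (hσ : ∀ (c : ℂ) (x : lp (fun _ : ι => ℂ) ∞), σ (c • x) = conj c • σ x) (hiso : ∀ x, ‖σ x‖ = ‖x‖)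
    (hfixρ : ∀ (k : ℕ) (P : ι → ℝ), σ (reading (wt k) P) = reading (wt k) P)
    {Φc : ℕ → ℝ → lp (fun _ : ι => ℂ) ∞ → Bg → C.Dom → ℂ} {r B₁ : ℝ} (hB₁ : 0 ≤ B₁)
    (hd : ∀ k, ∀ g ∈ W, ∀ (U : Bg) (X : C.Dom), C.scale X = k + 1 →
      DifferentiableOn ℂ (fun Q => Φc k (g k) Q U X) (ball 0 r))
    (hb : ∀ k, ∀ g ∈ W, ∀ (U : Bg) (X : C.Dom), C.scale X = k + 1 →
      ∀ Q ∈ ball (0 : lp (fun _ : ι => ℂ) ∞) r, ‖Φc k (g k) Q U X‖ ≤ Real.exp (-(κ * C.d X)) * B₁)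
    (hre : ∀ k, ∀ g ∈ W, ∀ s ∈ W, ∀ (U : Bg) (X : C.Dom), C.scale X = k + 1 →
      Ψ k (s k) (T k s (E g)) U X = (Φc k (s k) (reading (wt k) (T k s (E g))) U X).re) :
    ∀ k, ∀ g ∈ W, ∀ s ∈ W, reading (wt k) (T k s (E g)) ∈ ball (0 : lp (fun _ : ι => ℂ) ∞) r →
      ∀ (U : Bg) (X : C.Dom), (holoSlice κ σ Φc k (s k) (reading (wt k) (T k s (E g))) : Bg × C.Dom → ℂ) (U, X) =
        ((Real.exp (κ * C.d X) * restrictScale (k + 1) (Ψ k (s k) (T k s (E g))) U X : ℝ) : ℂ) := by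
  intro k g hg s hs hQ U X
  rw [holoSlice_apply_of_fixed hσ hiso hB₁ (hd k s hs) (hb k s hs) hQ (hfixρ k _) U X]
  by_cases hX : C.scale X = k + 1
  · rw [if_pos hX, restrictScale_of_eq _ hX, hre k g hg s hs U X hX]
  · rw [if_neg hX, restrictScale_of_ne _ hX, mul_zero, Complex.ofReal_zero]

/-- **ROUTE R4's END AT THE RECORD FROM A COMPLEX FAMILY MAP** — `NE9FutureProfileEndOfRecord.ne9_and_fadingMemory_of_holoSlice`
with `ΦY := holoSlice κ σ Φc`: the END of record's structural binders + a conjugation `σ` of the table space (conjugate-linear,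
isometric, fixing the weighted readings of real tables) + per-coordinate (c-holo) Fréchet holomorphy and (c-size) decay-weighted
bound `B₁` of the complex family map on the table ball `‖Q‖ < r` at every occurring last coupling + (c-real) «the record's new term
at the record's tables is `Re Φc`» + the room `ω̂·r + (√2·τ̄)·B₁ ≤ θ·r` ⇒
`NE9 E W κ (prodModuli ((2∕(1−θ))·ℓ) (fun _ => 2θ∕(1+θ))) ∧ FadingMemory …`. [cite: Balaban1988RG2Cluster, (2.13)-(2.15) pp.14-15] -/
theorem ne9_and_fadingMemory_of_holoFamily [Nonempty ι]
    (h0 : ∀ g ∈ W, ∀ (U : Bg) (X : C.Dom), C.scale X = 0 → E g U X = 0)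
    (hAdm : AdmissibleTerms E W Adm) (hres : AdmRestrict Adm) (hadd : ChannelAdditive Adm T) (hloc : ChannelLocal Adm T)
    (hstep : ChannelSizeAtStepNN Adm T κ wt τ) (hfac : Factorises E W T Ψ) {lam : ℕ → ℝ}
    (hlast : LastCouplingLipschitz E W T Ψ κ lam)
    (hsmul : ∀ (c : ℝ), ∀ H ∈ Adm, c • H ∈ Adm) (hne : Adm.Nonempty) (hwt : ∀ m y, 0 < wt m y)
    (hτ : ∀ k j, j ≤ k → 0 ≤ τ k j ∧ τ k j ≤ τbar * ω ^ (k - j)) (hτbar : 0 < τbar) (hω : 0 ≤ ω) (hωh : 0 < ωh)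
    (hωωh : ω ≤ ωh) {σ : lp (fun _ : ι => ℂ) ∞ →L[ℝ] lp (fun _ : ι => ℂ) ∞}
    (hσ : ∀ (c : ℂ) (x : lp (fun _ : ι => ℂ) ∞), σ (c • x) = conj c • σ x) (hiso : ∀ x, ‖σ x‖ = ‖x‖)
    (hfixρ : ∀ (k : ℕ) (P : ι → ℝ), σ (reading (wt k) P) = reading (wt k) P)
    {Φc : ℕ → ℝ → lp (fun _ : ι => ℂ) ∞ → Bg → C.Dom → ℂ} {r B₁ θ ℓ : ℝ} (hr : 0 < r) (hB₁ : 0 ≤ B₁) (hθ0 : 0 < θ)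
    (hθ1 : θ < 1) (hℓ : 0 ≤ ℓ)
    (hcd : ∀ k, ∀ g ∈ W, ∀ (U : Bg) (X : C.Dom), C.scale X = k + 1 →
      DifferentiableOn ℂ (fun Q => Φc k (g k) Q U X) (ball 0 r))
    (hcb : ∀ k, ∀ g ∈ W, ∀ (U : Bg) (X : C.Dom), C.scale X = k + 1 →
      ∀ Q ∈ ball (0 : lp (fun _ : ι => ℂ) ∞) r, ‖Φc k (g k) Q U X‖ ≤ Real.exp (-(κ * C.d X)) * B₁)
    (hcre : ∀ k, ∀ g ∈ W, ∀ s ∈ W, ∀ (U : Bg) (X : C.Dom), C.scale X = k + 1 →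
      Ψ k (s k) (T k s (E g)) U X = (Φc k (s k) (reading (wt k) (T k s (E g))) U X).re)
    (hroom : ωh * r + Real.sqrt 2 * τbar * B₁ ≤ θ * r) (hlam : ∀ k, lam k ≤ ℓ) :
    NE9 E W κ (prodModuli (2 / (1 - θ) * ℓ) fun _ => 2 * θ / (1 + θ)) ∧
      FadingMemory (2 / (1 - θ) * ℓ / (2 * θ / (1 + θ))) (2 * θ / (1 + θ))
        (prodModuli (2 / (1 - θ) * ℓ) fun _ => 2 * θ / (1 + θ)) :=
  ne9_and_fadingMemory_of_holoSlice h0 hAdm hres hadd hloc hstep hfac hlast hsmul hne hwt hτ hτbar hω hωh hωωh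
    (ΦY := holoSlice κ σ Φc) hr hB₁ hθ0 hθ1 hℓ
    (fun k g hg => holoSlice_differentiableOn hσ hiso hB₁ (hcd k g hg) (hcb k g hg))
    (fun k g hg => holoSlice_mapsTo hσ hiso hB₁ (hcd k g hg) (hcb k g hg))
    (holoSlice_real hσ hiso hfixρ hB₁ hcd hcb hcre) hroom hlam

end End

end Summit.QuantumFields.BalabanUV.T4Continuum.NE9HoloSliceOfFamily

end
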